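import Summits.Ventures.LatticeQCDFlow.Scaling.TwoLevelCycleSelection

/-!
HONEST FRAMING: exact (Metropolis-corrected) sampling algorithms for lattice gauge theory; figures
of merit are autocorrelation/cost numbers at stated couplings and volumes; no continuum-physics
claim.

# TwoLevelCycleWords — ALONG ANY WORD OF STEPS (HOT REDRAW ∕ RING ∕ IDLE) THE TWO-LEVEL LAW IS `(1−q)·π̃ + q·ρ` WITH `ρ` IN ONE OF THREE
# BOOKKEEPING STATES AND `q = (1 − p/2)^N`, `N` = THE NUMBER OF HOT REDRAWS CLOSING AN ODD RUN OF RINGS; HENCE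
# `‖δ_x K_s − π̃‖_TV ≤ (1 − p/2)^{N(s)}` FOR EVERY START AND EVERY WORD (lean-2 GEN-31, ours)

Venture-side (OURS).  Cell `lqcd-flow` (pub-lqcd), unit `pub-lqcd-lean-2-g31`, 2026-08-29.  Chapter R, file 2; setting of
`Scaling/TwoLevelCycleSelection`.  The three step kernels are carried abstractly: `κ 0 = R` (hot redraw: `R(x,y) = μ_0(y_0)𝟙{y_1 = x_1}`),
`κ 1 = G` (the two-point ring kernel), `κ 2 = 1` (idle), each fixing `π̃ = μ_0 ⊗ μ_1`.  BOOKKEEPING STATES: `0` = no hot redraw yet (any law);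
`1` = two-point representation with `a ≤ a_∞` (even run of rings since the last redraw); `2` = the same with `a ≥ a_∞` (odd run).  AUTOMATON:
a redraw sends every state to `1`, a ring fixes `0` and exchanges `1 ↔ 2`, idle fixes everything; the MULTIPLIER is `1 − p/2` at a redraw met in
state `2` and `1` otherwise.  The states, the automaton and the multiplier are hypothesis-parametrised (`Rep`, `δ`, `mult`), instantiated in
`Scaling/TwoLevelCycleLaw`.

## What is proved

* **`cycle_one_step`** — THE ONE-STEP LEMMA: a state-`i` law `ρ` is sent by step `c` to `(1 − m)·π̃ + m·ρ₁`, `ρ₁` a state-`δ(i,c)` law,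
  `m = mult(i,c)` (nine cases; the counted one splits `(p/2)·π̃` off the fresh-hub law by `ms_coldMarginal_ge` + `ms_zero_split`).
* **`cycle_word_decomp`** — THE WORD DECOMPOSITION `((1−q)π̃ + qρ)·K_s = (1−q')π̃ + q'ρ'` with `(state', q')` the automaton run (a `foldl`).
* `cycle_mult_nonneg`; **`cycle_word_tvDist`** — `‖(K_s)(x,·) − π̃‖_TV ≤ q'(s)` from every configuration `x` (start state `0`, `q = 1`).

Reading (no numerics implied): conditional on the SCHEDULE of step types the two-level chain is an inhomogeneous product of `π̃`-preserving kernels,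
and each completed odd block `[redraw, odd rings, redraw]` contracts the non-stationary part by `1 − p/2`, uniformly in the start — a Doeblin
argument at schedule-determined times, with no acceptance floor and no regime.  NOT CLAIMED: as in file 1.  Literature grade (cell rule): OWN
CONSTRUCTION; nothing cited as a fact; no new bib keys.
-/

noncomputable section

open Finset Function Matrix
open Literature.Probability.MarkovChains

namespace Summit.Ventures.LatticeQCDFlow.Scaling

variable {S : Type*} [Fintype S] [DecidableEq S]

section Words
variable {μ : Fin (1 + 1) → S → ℝ} (ψ : Equiv.Perm S) {p : ℝ}

/-! ## §6 The one-step lemma on the three bookkeeping states and the word decomposition -/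

/-- **THE ONE-STEP LEMMA.**  States `0` (no hot redraw yet: any law), `1` (hub fresh at the last redraw, even number of rings since: two-point
representation with `a ≤ a_∞`), `2` (odd number of rings since: `a ≥ a_∞`); steps `0` = hot redraw `R`, `1` = ring `G`, `2` = idle.  Every step
maps a state-`i` law `ρ` to `ρK = (1 − m)·π̃ + m·ρ₁` with `ρ₁` a state-`δ(i,·)` law, where `m = 1` except for THE HOT REDRAW FROM STATE `2`, WHERE
`m = 1 − p/2`: the cold marginal above the Barker level carries `(p/2)·μ_1`, and the fresh hub completes it to `(p/2)·π̃`. [ours] -/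
theorem cycle_one_step (hμ : ∀ k x, 0 < μ k x) (hμ1 : ∀ k, ∑ u, μ k u = 1) (hp1 : p ≤ 1)
    (hdom : ∀ u, p * μ 1 (ψ u) ≤ μ 0 u)
    (αv : S → S → ℝ) (hαv : ∀ v d, αv v d = min 1 (μ 0 (ψ.symm d) * μ 1 (ψ v) / (μ 0 v * μ 1 d)))
    (ainf : S → S → ℝ) (hainf : ∀ v d, ainf v d = αv v d / (αv v d + αv (ψ.symm d) (ψ v)))
    (ms : (S → ℝ) → (S → S → ℝ) → (Fin (1 + 1) → S) → ℝ)
    (hms : ∀ lam a y, ms lam a y = lam (y 1) * μ 0 (y 0) * (1 - a (y 0) (y 1))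
      + lam (ψ (y 0)) * μ 0 (ψ.symm (y 1)) * a (ψ.symm (y 1)) (ψ (y 0)))
    (Rep : Fin 3 → ((Fin (1 + 1) → S) → ℝ) → Prop)
    (hRep0 : ∀ ρ, Rep 0 ρ ↔ ((∀ y, 0 ≤ ρ y) ∧ ∑ y, ρ y = 1))
    (hRep1 : ∀ ρ, Rep 1 ρ ↔ ∃ (lam : S → ℝ) (a : S → S → ℝ), (∀ u, 0 ≤ lam u) ∧ ∑ u, lam u = 1 ∧
      (∀ v d, 0 ≤ a v d ∧ a v d ≤ ainf v d) ∧ ρ = ms lam a)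
    (hRep2 : ∀ ρ, Rep 2 ρ ↔ ∃ (lam : S → ℝ) (a : S → S → ℝ), (∀ u, 0 ≤ lam u) ∧ ∑ u, lam u = 1 ∧
      (∀ v d, ainf v d ≤ a v d ∧ a v d ≤ 1) ∧ ρ = ms lam a)
    (κ : Fin 3 → Matrix (Fin (1 + 1) → S) (Fin (1 + 1) → S) ℝ)
    (hκ0 : ∀ x y, κ 0 x y = if y 1 = x 1 then μ 0 (y 0) else 0)
    (hκ1 : ∀ x y, κ 1 x y = (if y = x then 1 - αv (x 0) (x 1) else 0)
      + (if y = edgeFlowSwap ψ 0 1 x then αv (x 0) (x 1) else 0))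
    (hκ2 : κ 2 = 1)
    (δ : Fin 3 → Fin 3 → Fin 3) (hδ0 : ∀ i, δ i 0 = 1) (hδ2 : ∀ i, δ i 2 = i) (hδ01 : δ 0 1 = 0) (hδ11 : δ 1 1 = 2)
    (hδ21 : δ 2 1 = 1)
    (mult : Fin 3 → Fin 3 → ℝ) (hmult : ∀ i c, mult i c = if i = 2 ∧ c = 0 then 1 - p / 2 else 1)
    (i c : Fin 3) (ρ : (Fin (1 + 1) → S) → ℝ) (hρ : Rep i ρ) :
    ∃ ρ₁, Rep (δ i c) ρ₁ ∧ ρ ᵥ* κ c = (1 - mult i c) • tensorFun μ + mult i c • ρ₁ := by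
  have hfin3 : ∀ j : Fin 3, j = 0 ∨ j = 1 ∨ j = 2 := by decide
  -- every bookkeeping state is a probability vector
  have hprob : (∀ y, 0 ≤ ρ y) ∧ ∑ y, ρ y = 1 := by
    rcases hfin3 i with rfl | rfl | rfl
    · exact (hRep0 ρ).mp hρ
    · obtain ⟨lam, a, hl0, hl1, ha, rfl⟩ := (hRep1 _).mp hρ
      exact ms_basic ψ (fun u => (hμ 0 u).le) (hμ1 0) ms hms hl0 hl1
        (fun v d => ⟨(ha v d).1, (ha v d).2.trans (by rw [hainf]; exact (pairAccept_basic ψ hμ αv hαv v d).2.2.2.2)⟩)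
    · obtain ⟨lam, a, hl0, hl1, ha, rfl⟩ := (hRep2 _).mp hρ
      exact ms_basic ψ (fun u => (hμ 0 u).le) (hμ1 0) ms hms hl0 hl1
        (fun v d => ⟨le_trans (by rw [hainf]; exact (pairAccept_basic ψ hμ αv hαv v d).2.2.2.1) (ha v d).1, (ha v d).2⟩)
  -- the trivial multiplier
  have htriv : ∀ ρ₁ : (Fin (1 + 1) → S) → ℝ, ρ₁ = (1 - (1 : ℝ)) • tensorFun μ + (1 : ℝ) • ρ₁ := fun ρ₁ => by
    rw [sub_self, zero_smul, zero_add, one_smul]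
  rcases hfin3 c with rfl | rfl | rfl
  · -- the hot redraw
    have hR := vecMul_redraw ψ (κ 0) hκ0 ms hms ρ
    have hmarg := coldMarginal_basic ρ hprob.1 hprob.2
    by_cases hi : i = 2
    · -- counted: split off `(p/2)·π̃`
      subst hi
      obtain ⟨lam, a, hl0, hl1, ha, rfl⟩ := (hRep2 _).mp hρ
      have hge : ∀ u, p / 2 * μ 1 u ≤ ∑ x, ms lam a x * (if x 1 = u then 1 else 0) := fun u =>
        ms_coldMarginal_ge ψ hμ (hμ1 0) hdom ms hms hl0 hl1 (fun v d => (ha v d).2)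
          (fun v d => by have h := (ha v d).1; rw [hainf, hαv, hαv] at h; exact h) u
      have hβ1 : p / 2 < 1 := by linarith
      have hl''0 : ∀ u, 0 ≤ ((∑ x, ms lam a x * (if x 1 = u then (1 : ℝ) else 0)) - p / 2 * μ 1 u) / (1 - p / 2) :=
        fun u => div_nonneg (sub_nonneg.mpr (hge u)) (by linarith)
      have hl''1 : ∑ u, ((∑ x, ms lam a x * (if x 1 = u then (1 : ℝ) else 0)) - p / 2 * μ 1 u) / (1 - p / 2) = 1 := by
        rw [← sum_div, sum_sub_distrib, hmarg.2, ← mul_sum, hμ1 1, mul_one, div_self (by linarith)]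
      refine ⟨ms (fun u => ((∑ x, ms lam a x * (if x 1 = u then (1 : ℝ) else 0)) - p / 2 * μ 1 u) / (1 - p / 2))
        (fun _ _ => 0), ?_, ?_⟩
      · rw [hδ0]
        exact (hRep1 _).mpr ⟨_, fun _ _ => 0, hl''0, hl''1,
          fun v d => ⟨le_rfl, by rw [hainf]; exact (pairAccept_basic ψ hμ αv hαv v d).2.2.2.1⟩, rfl⟩
      · rw [hR, hmult, if_pos ⟨rfl, rfl⟩, show (1 : ℝ) - (1 - p / 2) = p / 2 by ring]
        exact ms_zero_split ψ ms hms (β := p / 2) (by linarith) _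
    · -- uncounted: the redraw lands in state `1` with `a = 0`
      refine ⟨ρ ᵥ* κ 0, ?_, ?_⟩
      · rw [hδ0]
        exact (hRep1 _).mpr ⟨_, fun _ _ => 0, hmarg.1, hmarg.2,
          fun v d => ⟨le_rfl, by rw [hainf]; exact (pairAccept_basic ψ hμ αv hαv v d).2.2.2.1⟩, hR⟩
      · rw [hmult, if_neg (fun h => hi h.1)]; exact htriv _
  · -- the ring
    have hm : mult i 1 = 1 := by rw [hmult, if_neg (fun h => absurd h.2 (by decide))]
    rw [hm]
    rcases hfin3 i with rfl | rfl | rfl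
    · -- no redraw yet: any law stays a law
      refine ⟨ρ ᵥ* κ 1, ?_, htriv _⟩
      rw [hδ01, hRep0]
      have hαb := pairAccept_basic ψ hμ αv hαv
      constructor
      · intro y
        rw [vecMul_ring_apply ψ αv (κ 1) hκ1]
        exact add_nonneg (mul_nonneg (sub_nonneg.mpr (hαb _ _).2.1) (hprob.1 y))
          (mul_nonneg (hαb _ _).1 (hprob.1 _))
      · simp_rw [vecMul_ring_apply ψ αv (κ 1) hκ1]
        rw [sum_add_distrib]
        have hre : ∑ y : Fin (1 + 1) → S, αv (ψ.symm (y 1)) (ψ (y 0)) * ρ (edgeFlowSwap ψ 0 1 y)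
            = ∑ x : Fin (1 + 1) → S, αv (x 0) (x 1) * ρ x := by
          refine Fintype.sum_bijective (edgeFlowSwap ψ 0 1)
            (Function.Involutive.bijective fun x => edgeFlowSwap_edgeFlowSwap ψ (by decide) x) _ _ fun y => ?_
          rw [(edgeFlowSwap_two_apply ψ y).1, (edgeFlowSwap_two_apply ψ y).2]
        rw [hre, ← sum_add_distrib]
        calc ∑ x, ((1 - αv (x 0) (x 1)) * ρ x + αv (x 0) (x 1) * ρ x) = ∑ x, ρ x := sum_congr rfl fun x _ => by ring
          _ = 1 := hprob.2
    · -- from state `1` to state `2`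
      obtain ⟨lam, a, hl0, hl1, ha, rfl⟩ := (hRep1 _).mp hρ
      refine ⟨_, ?_, (ms_vecMul_ring ψ αv (κ 1) hκ1 ms hms lam a).trans (htriv _)⟩
      rw [hδ11, hRep2]
      refine ⟨lam, _, hl0, hl1, fun v d => ?_, rfl⟩
      have hb := pairAccept_basic ψ hμ αv hαv v d
      have hf := (barker_flip (a := a v d) hb.2.1 (pairAccept_basic ψ hμ αv hαv (ψ.symm d) (ψ v)).2.1 hb.2.2.1).1
        (ha v d).1 (by rw [← hainf]; exact (ha v d).2)
      rw [hainf]; exact hf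
    · -- from state `2` to state `1`
      obtain ⟨lam, a, hl0, hl1, ha, rfl⟩ := (hRep2 _).mp hρ
      refine ⟨_, ?_, (ms_vecMul_ring ψ αv (κ 1) hκ1 ms hms lam a).trans (htriv _)⟩
      rw [hδ21, hRep1]
      refine ⟨lam, _, hl0, hl1, fun v d => ?_, rfl⟩
      have hb := pairAccept_basic ψ hμ αv hαv v d
      have hf := (barker_flip (a := a v d) hb.2.1 (pairAccept_basic ψ hμ αv hαv (ψ.symm d) (ψ v)).2.1 hb.2.2.1).2
        (by rw [← hainf]; exact (ha v d).1) (ha v d).2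
      rw [hainf]; exact hf
  · -- idle
    refine ⟨ρ, ?_, ?_⟩
    · rw [hδ2]; exact hρ
    · rw [hκ2, Matrix.vecMul_one, hmult, if_neg (fun h => absurd h.2 (by decide))]
      exact htriv ρ

/-- **THE WORD DECOMPOSITION.**  Along any word `s` of steps (applied left to right), a state-`i` law `ρ` mixed as `(1−q)·π̃ + q·ρ` is carried to
`(1−q')·π̃ + q'·ρ'` with `ρ'` a law of the final bookkeeping state and `q' = q·Π(multipliers)` — i.e. `q' = q·(1 − p/2)^{N}`, `N` = the number of
hot redraws met in state `2` (an odd run of rings since the previous redraw); every step kernel fixes `π̃`. [ours] -/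
theorem cycle_word_decomp (hμ : ∀ k x, 0 < μ k x) (hμ1 : ∀ k, ∑ u, μ k u = 1) (hp1 : p ≤ 1)
    (hdom : ∀ u, p * μ 1 (ψ u) ≤ μ 0 u)
    (αv : S → S → ℝ) (hαv : ∀ v d, αv v d = min 1 (μ 0 (ψ.symm d) * μ 1 (ψ v) / (μ 0 v * μ 1 d)))
    (ainf : S → S → ℝ) (hainf : ∀ v d, ainf v d = αv v d / (αv v d + αv (ψ.symm d) (ψ v)))
    (ms : (S → ℝ) → (S → S → ℝ) → (Fin (1 + 1) → S) → ℝ)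
    (hms : ∀ lam a y, ms lam a y = lam (y 1) * μ 0 (y 0) * (1 - a (y 0) (y 1))
      + lam (ψ (y 0)) * μ 0 (ψ.symm (y 1)) * a (ψ.symm (y 1)) (ψ (y 0)))
    (Rep : Fin 3 → ((Fin (1 + 1) → S) → ℝ) → Prop)
    (hRep0 : ∀ ρ, Rep 0 ρ ↔ ((∀ y, 0 ≤ ρ y) ∧ ∑ y, ρ y = 1))
    (hRep1 : ∀ ρ, Rep 1 ρ ↔ ∃ (lam : S → ℝ) (a : S → S → ℝ), (∀ u, 0 ≤ lam u) ∧ ∑ u, lam u = 1 ∧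
      (∀ v d, 0 ≤ a v d ∧ a v d ≤ ainf v d) ∧ ρ = ms lam a)
    (hRep2 : ∀ ρ, Rep 2 ρ ↔ ∃ (lam : S → ℝ) (a : S → S → ℝ), (∀ u, 0 ≤ lam u) ∧ ∑ u, lam u = 1 ∧
      (∀ v d, ainf v d ≤ a v d ∧ a v d ≤ 1) ∧ ρ = ms lam a)
    (κ : Fin 3 → Matrix (Fin (1 + 1) → S) (Fin (1 + 1) → S) ℝ)
    (hκ0 : ∀ x y, κ 0 x y = if y 1 = x 1 then μ 0 (y 0) else 0)
    (hκ1 : ∀ x y, κ 1 x y = (if y = x then 1 - αv (x 0) (x 1) else 0)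
      + (if y = edgeFlowSwap ψ 0 1 x then αv (x 0) (x 1) else 0))
    (hκ2 : κ 2 = 1) (hstat : ∀ c, tensorFun μ ᵥ* κ c = tensorFun μ)
    (δ : Fin 3 → Fin 3 → Fin 3) (hδ0 : ∀ i, δ i 0 = 1) (hδ2 : ∀ i, δ i 2 = i) (hδ01 : δ 0 1 = 0) (hδ11 : δ 1 1 = 2)
    (hδ21 : δ 2 1 = 1)
    (mult : Fin 3 → Fin 3 → ℝ) (hmult : ∀ i c, mult i c = if i = 2 ∧ c = 0 then 1 - p / 2 else 1)
    (s : List (Fin 3)) :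
    ∀ (i : Fin 3) (q : ℝ) (ρ : (Fin (1 + 1) → S) → ℝ), Rep i ρ →
      ∃ ρ', Rep (s.foldl (fun st c => (δ st.1 c, st.2 * mult st.1 c)) (i, q)).1 ρ' ∧
        ((1 - q) • tensorFun μ + q • ρ) ᵥ* (s.map κ).prod
          = (1 - (s.foldl (fun st c => (δ st.1 c, st.2 * mult st.1 c)) (i, q)).2) • tensorFun μ
            + (s.foldl (fun st c => (δ st.1 c, st.2 * mult st.1 c)) (i, q)).2 • ρ' := by
  induction s with
  | nil =>
    intro i q ρ h
    exact ⟨ρ, h, by rw [List.map_nil, List.prod_nil, Matrix.vecMul_one]; rfl⟩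
  | cons c s ih =>
    intro i q ρ h
    obtain ⟨ρ₁, h₁, hstep⟩ := cycle_one_step ψ hμ hμ1 hp1 hdom αv hαv ainf hainf ms hms Rep hRep0 hRep1 hRep2 κ hκ0 hκ1 hκ2
      δ hδ0 hδ2 hδ01 hδ11 hδ21 mult hmult i c ρ h
    rw [List.foldl_cons, List.map_cons, List.prod_cons, ← Matrix.vecMul_vecMul]
    have hc : ((1 - q) • tensorFun μ + q • ρ) ᵥ* κ c = (1 - q * mult i c) • tensorFun μ + (q * mult i c) • ρ₁ := by
      rw [Matrix.add_vecMul, Matrix.smul_vecMul, Matrix.smul_vecMul, hstat, hstep, smul_add, smul_smul, smul_smul,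
        ← add_assoc, ← add_smul]
      congr 1
      ring_nf
    rw [hc]
    exact ih (δ i c) (q * mult i c) ρ₁ h₁

/-- The running multiplier stays non-negative for `q ≥ 0` (`p ≤ 2`). [ours] -/
theorem cycle_mult_nonneg (hp2 : p ≤ 2) (δ : Fin 3 → Fin 3 → Fin 3)
    (mult : Fin 3 → Fin 3 → ℝ) (hmult : ∀ i c, mult i c = if i = 2 ∧ c = 0 then 1 - p / 2 else 1)
    (s : List (Fin 3)) : ∀ (i : Fin 3) (q : ℝ), 0 ≤ q →
      0 ≤ (s.foldl (fun st c => (δ st.1 c, st.2 * mult st.1 c)) (i, q)).2 := by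
  have hm : ∀ i c, 0 ≤ mult i c := fun i c => by
    rw [hmult]; split_ifs <;> linarith
  induction s with
  | nil => intro i q hq; exact hq
  | cons c s ih =>
    intro i q hq
    rw [List.foldl_cons]
    exact ih (δ i c) (q * mult i c) (mul_nonneg hq (hm i c))

/-- **THE COLD-START LAW ALONG A WORD:** from any configuration `x`, after the steps of `s` the law is within total variation
`(1 − p/2)^{N(s)}` of `π̃`, `N(s)` = the number of hot redraws closing an odd run of rings since the previous hot redraw (the running multiplier
started at `1` in state `0`). [ours] -/
theorem cycle_word_tvDist (hμ : ∀ k x, 0 < μ k x) (hμ1 : ∀ k, ∑ u, μ k u = 1) (hp1 : p ≤ 1)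
    (hdom : ∀ u, p * μ 1 (ψ u) ≤ μ 0 u)
    (αv : S → S → ℝ) (hαv : ∀ v d, αv v d = min 1 (μ 0 (ψ.symm d) * μ 1 (ψ v) / (μ 0 v * μ 1 d)))
    (ainf : S → S → ℝ) (hainf : ∀ v d, ainf v d = αv v d / (αv v d + αv (ψ.symm d) (ψ v)))
    (ms : (S → ℝ) → (S → S → ℝ) → (Fin (1 + 1) → S) → ℝ)
    (hms : ∀ lam a y, ms lam a y = lam (y 1) * μ 0 (y 0) * (1 - a (y 0) (y 1))
      + lam (ψ (y 0)) * μ 0 (ψ.symm (y 1)) * a (ψ.symm (y 1)) (ψ (y 0)))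
    (Rep : Fin 3 → ((Fin (1 + 1) → S) → ℝ) → Prop)
    (hRep0 : ∀ ρ, Rep 0 ρ ↔ ((∀ y, 0 ≤ ρ y) ∧ ∑ y, ρ y = 1))
    (hRep1 : ∀ ρ, Rep 1 ρ ↔ ∃ (lam : S → ℝ) (a : S → S → ℝ), (∀ u, 0 ≤ lam u) ∧ ∑ u, lam u = 1 ∧
      (∀ v d, 0 ≤ a v d ∧ a v d ≤ ainf v d) ∧ ρ = ms lam a)
    (hRep2 : ∀ ρ, Rep 2 ρ ↔ ∃ (lam : S → ℝ) (a : S → S → ℝ), (∀ u, 0 ≤ lam u) ∧ ∑ u, lam u = 1 ∧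
      (∀ v d, ainf v d ≤ a v d ∧ a v d ≤ 1) ∧ ρ = ms lam a)
    (κ : Fin 3 → Matrix (Fin (1 + 1) → S) (Fin (1 + 1) → S) ℝ)
    (hκ0 : ∀ x y, κ 0 x y = if y 1 = x 1 then μ 0 (y 0) else 0)
    (hκ1 : ∀ x y, κ 1 x y = (if y = x then 1 - αv (x 0) (x 1) else 0)
      + (if y = edgeFlowSwap ψ 0 1 x then αv (x 0) (x 1) else 0))
    (hκ2 : κ 2 = 1) (hstat : ∀ c, tensorFun μ ᵥ* κ c = tensorFun μ)
    (δ : Fin 3 → Fin 3 → Fin 3) (hδ0 : ∀ i, δ i 0 = 1) (hδ2 : ∀ i, δ i 2 = i) (hδ01 : δ 0 1 = 0) (hδ11 : δ 1 1 = 2)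
    (hδ21 : δ 2 1 = 1)
    (mult : Fin 3 → Fin 3 → ℝ) (hmult : ∀ i c, mult i c = if i = 2 ∧ c = 0 then 1 - p / 2 else 1)
    (x : Fin (1 + 1) → S) (s : List (Fin 3)) :
    tvDist (fun y => (s.map κ).prod x y) (tensorFun μ)
      ≤ (s.foldl (fun st c => (δ st.1 c, st.2 * mult st.1 c)) (0, 1)).2 := by
  have hπ0 : ∀ y, 0 ≤ tensorFun μ y := fun y => (tensorFun_pos hμ y).le
  have hπ1 : ∑ y, tensorFun μ y = 1 := sum_tensorFun_eq_one μ hμ1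
  -- the start is a state-`0` law
  have hx : Rep 0 (Pi.single x 1) := (hRep0 _).mpr
    ⟨fun y => by rw [Pi.single_apply]; split_ifs <;> norm_num,
      by rw [Finset.sum_pi_single' x (1 : ℝ) univ, if_pos (mem_univ _)]⟩
  obtain ⟨ρ', hρ', heq⟩ := cycle_word_decomp ψ hμ hμ1 hp1 hdom αv hαv ainf hainf ms hms Rep hRep0 hRep1 hRep2 κ hκ0 hκ1 hκ2
    hstat δ hδ0 hδ2 hδ01 hδ11 hδ21 mult hmult s 0 1 (Pi.single x 1) hx
  set q' := (s.foldl (fun st c => (δ st.1 c, st.2 * mult st.1 c)) (0, 1)).2 with hq'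
  have hq0 : 0 ≤ q' := cycle_mult_nonneg (by linarith) δ mult hmult s 0 1 zero_le_one
  -- the final law is a probability vector
  have hfin3 : ∀ j : Fin 3, j = 0 ∨ j = 1 ∨ j = 2 := by decide
  have hprob : (∀ y, 0 ≤ ρ' y) ∧ ∑ y, ρ' y = 1 := by
    rcases hfin3 (s.foldl (fun st c => (δ st.1 c, st.2 * mult st.1 c)) (0, 1)).1 with h | h | h <;> rw [h] at hρ'
    · exact (hRep0 _).mp hρ'
    · obtain ⟨lam, a, hl0, hl1, ha, rfl⟩ := (hRep1 _).mp hρ'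
      exact ms_basic ψ (fun u => (hμ 0 u).le) (hμ1 0) ms hms hl0 hl1
        (fun v d => ⟨(ha v d).1, (ha v d).2.trans (by rw [hainf]; exact (pairAccept_basic ψ hμ αv hαv v d).2.2.2.2)⟩)
    · obtain ⟨lam, a, hl0, hl1, ha, rfl⟩ := (hRep2 _).mp hρ'
      exact ms_basic ψ (fun u => (hμ 0 u).le) (hμ1 0) ms hms hl0 hl1
        (fun v d => ⟨le_trans (by rw [hainf]; exact (pairAccept_basic ψ hμ αv hαv v d).2.2.2.1) (ha v d).1, (ha v d).2⟩)
  -- the row of the word kernel is the carried law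
  have hrow : (fun y => (s.map κ).prod x y) = (1 - q') • tensorFun μ + q' • ρ' := by
    rw [← heq, sub_self, zero_smul, zero_add, one_smul, Matrix.single_one_vecMul]
    rfl
  rw [hrow]
  have htv : tvDist ((1 - q') • tensorFun μ + q' • ρ') (tensorFun μ) = q' * tvDist ρ' (tensorFun μ) := by
    unfold tvDist
    have habs : ∀ y, |((1 - q') • tensorFun μ + q' • ρ') y - tensorFun μ y| = q' * |ρ' y - tensorFun μ y| := fun y => by
      rw [Pi.add_apply, Pi.smul_apply, Pi.smul_apply, smul_eq_mul, smul_eq_mul,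
        show (1 - q') * tensorFun μ y + q' * ρ' y - tensorFun μ y = q' * (ρ' y - tensorFun μ y) by ring, abs_mul,
        abs_of_nonneg hq0]
    simp_rw [habs]
    rw [← mul_sum]
    ring
  rw [htv]
  exact (mul_le_mul_of_nonneg_left (tvDist_le_one hprob.1 hπ0 hprob.2 hπ1) hq0).trans (by rw [mul_one])

end Words

end Summit.Ventures.LatticeQCDFlow.Scaling

end
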